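import Summits.BirchSwinnertonDyer.BirchSwinnertonDyer.Theorems.KimAtThreeKolyvaginDeepLowerNestedEnd
import Summits.BirchSwinnertonDyer.Rank1Residual.GaloisImage.KuriharaRecordCorollaryThreeWith
import Summits.BirchSwinnertonDyer.Rank1Residual.GaloisImage.KuriharaRecordBSDpThreeLevelTwoEndNoEP
import HarnessLib

/-!
# Crux `DeepLowerAtThree` (item stmt-BirchSwinnertonDyer-19075) on the KATO STRATUM at `t = 0`, GRANTED cell
# n1011's (a′) typed inputs — route W2 `KimAtThreeKolyvagin`, cell `bsd-addord`, seat kim3 gen 8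

HONEST FRAMING. Theorems only (no definition, no named fact, no `sorry`); nothing asserted, nothing booked, no
mark moved; crux 19075 stays OPEN.  CONDITIONAL on exactly the inputs of n1011's record-ready corollary
`Assembly.exists_LOmega_padicValRat_le_of_towerSurj_with` (KuriharaRecordCorollaryThreeWith.lean) MINUS `h26`,
`hmod`, `hEP`: the two [S24] Thm. 4.4 (1)(2) facts `hS24`/`hS24₂` (typed weaker than print, PUB), GZK `hGZK` (PUB),
the Poitou–Tate families `inv`/`inv′` with their duality properties (data binders), ONE repaired dictionary port
`KatoKuriharaPortThreeAtWith₂ W 0 v₃ η D` at the row's own datum (FLAG `K22-Thm3.13-PORT@3`: Kim's refined explicit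
reciprocity law at an additive `3` — NOT in print at `3`; = memo kim3/KIM3-PROOF.md §4 Prop. D, REF PASS; kernel-open,
the SAME debt crux 19076 `DeepUpperAtThree` carries); Tate's local Euler–Poincaré characteristic is DISCHARGED by
name (`Assembly.localEulerPoincareCharacteristic_rat`, proved in the tree) and the Manin datum is carried as
`3 ∤ c_D` + the period transfer (or optimality), not as Cremona's table.

WHAT.  The `∂`-currency statement of crux 19075 for the newform `D.f` of a parametrisation datum `D` (level = the
conductor) of a row {`3`-adic tower onto, ADDITIVE at `3` with `3 ∤ c₃`, `E(ℚ₃)[3] = 0`, `ord(δ̃) = 0`, `3 ∤ c_D`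
+ period transfer}: `∂^{(∞)}_deep(δ̃) = d ∈ ℕ` and `∂⁽⁰⁾(δ̃) ≤ ord₃ #Ш(E/ℚ)(3) + d`.  Road: (1) n1011's END theorem at
EVERY shallow depth `k` and certificate modulus `3^j`, `j ≤ k + 1` (the file
`KimAtThreeKolyvaginDeepLowerNestedEnd.lean` supplies the nested-only variant that the pinned tower family of
`TowerPackage.exists_towerFamily_with` can feed at `k > 0`) ⟹ `exists_LOmega_padicValRat_le_of_towerSurj_with_depth`
= Cor C-t of the memo at `t = 0` for every depth, in BSD currency, certificate MINIMAL; (2) minimality removed by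
descent to the least certified divisor (`…_of_anyCertificate`); (3) gen 7's dictionary
`deepLower_conclusion_iff_eventuallyDivisible` (p415298) + reverse bridge
`kuriharaPartial_zero_le_natCast_of_padicValRat_le` (p415993) ⟹ `deepLower_datum_of_ports` /
`deepLower_optimal_of_ports` (step (3) is the sequel file `KimAtThreeKolyvaginDeepLowerKatoStratumPartial.lean`; this
file = steps (0)–(2), BSD currency).  Effect: the `@[conjecture]` NAME `N11.KimAtThreeDeepCertPUB` in gen 7's
`deepLower_optimal_of_kimAtThreeDeepCertPUB` is replaced, on the `3 ∤ c₃ ∧ t = 0` stratum, by n1011's port-facts.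
NOT COVERED: `3 ∣ c₃` (the dictionary antecedent (A2) fails; memo Prop. D's `3^{v₃(c₃)}` shift), `t ≥ 1` (the
repaired port exists at `t = 0` only; the deep road uses the unrepaired `KatoKuriharaPortThreeAt`), non-additive `3`.
References: [Kim2025RefinedTNC] Thm 1.1; [Kim2022StructureSelmer] Thm. 1.9 (6), 3.13; [Sakamoto2024] Thm. 4.4;
[MazurRubin2004] Thm. 5.2.12; memo `run/shared/lean/pub/bsd-addord/kim3/KIM3-PROOF.md` §16 (Cor C-t).
-/

set_option autoImplicit false
-- the Theorems namespace of a single-conjunct summit repeats the summit name by design (D-0017)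
set_option linter.dupNamespace false

noncomputable section

open scoped Classical NumberField ContRepresentation
open Function Field NumberField IsDedekindDomain IsDedekindDomain.HeightOneSpectrum WeierstrassCurve
  CongruenceSubgroup
  Literature.NumberTheory.EllipticCurves Literature.NumberTheory.EllipticCurves.ModularForms
  Literature.NumberTheory.EllipticCurves.Rank1Residual
  Literature.NumberTheory.GaloisRepresentations
  Literature.NumberTheory.GaloisRepresentations.DiscreteGaloisModule Literature.NumberTheory.GaloisCohomology
  Rat.HeightOneSpectrum
  Summit.BirchSwinnertonDyer.Rank1Residual.GaloisImage
  Summit.BirchSwinnertonDyer.Rank1Residual.GaloisImage.Assembly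
  Summit.BirchSwinnertonDyer.Rank1Residual.X4
  Summit.BirchSwinnertonDyer.BirchSwinnertonDyer.Theorems.KimAtThreeKolyvaginDeepLowerNestedEnd

namespace Summit.BirchSwinnertonDyer.BirchSwinnertonDyer.Theorems.KimAtThreeKolyvaginDeepLowerKatoStratum

/-! ### (0) n1011's cyclic-flag END with the nested-only deep family -/

/-- **n1011's `Assembly.padicValRat_le_of_kolyvaginProduct_of_card_torsion_le_at` with the deep-family
nesting binder restricted to depths `k′ ≥ k`**; statement and proof otherwise verbatim (adapter (M):
the cyclicity flag in the records' currency `#(E₀ mod ℓ)(𝔽_ℓ)[3] ≤ 3`, the exceptional set `S` only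
inside `{bad} ∪ {v ∣ 3}`; adapted from `Rank1Residual/GaloisImage/KuriharaLowerBoundThreeOfKolyvaginProductCyclicAt.lean`,
credit cell b2b-bsdres n1011). [cite: Kim2022StructureSelmer, Thm. 1.9 (6), §1.2.2 and §1.4.3]
[cite: Sakamoto2024, §2 and Thm. 4.4] [cite: SilvermanAEC2009, Prop. VII.1.3(b)] -/
theorem padicValRat_le_of_kolyvaginProduct_of_card_torsion_le_nested_at
    (W : WeierstrassCurve ℚ) [W.IsElliptic] [W.IsGloballyMinimal] (t k : ℕ)
    (D : KolyvaginDatum (W.torsionGaloisModule (((3 : ℕ) : ℤ) ^ k * ((3 : ℕ) : ℤ))))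
    (v₃ : HeightOneSpectrum (𝓞 ℚ)) (hv₃ : ((3 : ℕ) : 𝓞 ℚ) ∈ v₃.asIdeal)
    -- the row
    (hadd : Addv W 3) (hc3 : ¬ 3 ∣ (W.baseChange ℚ_[3]).localTamagawaNumber ℤ_[3])
    (hsurj : W.HasSurjectiveModNGaloisRep ((3 : ℕ) : ℤ))
    (ht : Nat.card {Q : (W.baseChange ℚ_[3]).toAffine.Point // (3 : ℕ) • Q = 0} = 3 ^ t)
    (hL : W.entireLFunction 1 ≠ 0) [Finite W.toAffine.Point] [Finite W.sha]
    {N : ℕ} [NeZero N] (P : ModularParametrizationData W N) (hcP : ¬ ((3 : ℕ) : ℤ) ∣ P.maninConstant)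
    (hper : ∃ u : ℚ, ‖(u : ℚ_[3])‖ = 1 ∧ W.realPeriodRat = u * plusPeriod P.f)
    -- the shallow datum
    (hDT : D.transverse = cyclotomicTransverse _)
    (g : Finset (HeightOneSpectrum (𝓞 ℚ)) →
      galoisCohomology (W.torsionGaloisModule (((3 : ℕ) : ℤ) ^ k * ((3 : ℕ) : ℤ))) 1)
    (hg : g ∈ D.kolyvaginSystems (propagatedSelmerStructure W 3 k))
    (hgen : ∀ κ ∈ D.kolyvaginSystems (propagatedSelmerStructure W 3 k), ∃ a : ℕ, κ = a • g)
    -- the deep inputs, at every depth `k′`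
    (D' : ∀ k' : ℕ, KolyvaginDatum (W.torsionGaloisModule (((3 : ℕ) : ℤ) ^ k' * ((3 : ℕ) : ℤ))))
    (hDT' : ∀ k', (D' k').transverse = cyclotomicTransverse _)
    (hPP' : ∀ k', k ≤ k' → (D' k').primes ⊆ D.primes)
    (red : ∀ k' : ℕ, (W.torsionGaloisModule (((3 : ℕ) : ℤ) ^ k' * ((3 : ℕ) : ℤ))).toContRepresentation
      →ⁱL (W.torsionGaloisModule (((3 : ℕ) : ℤ) ^ k * ((3 : ℕ) : ℤ))).toContRepresentation)
    (hred : ∀ k', ∀ x : geomTorsion W (((3 : ℕ) : ℤ) ^ k' * ((3 : ℕ) : ℤ)),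
      ((red k' x : geomTorsion W (((3 : ℕ) : ℤ) ^ k * ((3 : ℕ) : ℤ))) : geomPoints W) =
        (((3 : ℕ) : ℤ) ^ (k' - k)) • (x : geomPoints W))
    (hdict : ∀ k', k ≤ k' → KatoKuriharaDictionaryThreeAt₂At W t k k' D (D' k') (red k') v₃ P)
    (g' : ∀ k' : ℕ, Finset (HeightOneSpectrum (𝓞 ℚ)) →
      galoisCohomology (W.torsionGaloisModule (((3 : ℕ) : ℤ) ^ k' * ((3 : ℕ) : ℤ))) 1)
    (hg' : ∀ k', g' k' ∈ (D' k').kolyvaginSystems (propagatedSelmerStructure W 3 k'))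
    (hgo' : ∀ k', addOrderOf (g' k') = 3 ^ (k' + 1))
    (hgen' : ∀ k', ∀ κ ∈ (D' k').kolyvaginSystems (propagatedSelmerStructure W 3 k'),
      ∃ a : ℕ, κ = a • g' k')
    (inv' : ∀ k' : ℕ, LocalInvariants ℚ (3 ^ (k' + 1))) (hperf' : ∀ k', (inv' k').IsPerfect)
    (hsum' : ∀ k', (inv' k').SumLocalTermEqZero) (hcompl' : ∀ k', (inv' k').SelmerComplement)
    (hinj' : ∀ k', ∀ v : HeightOneSpectrum (𝓞 ℚ), Injective (inv' k' (Sum.inr v)))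
    (hEP : ∀ v : HeightOneSpectrum (𝓞 ℚ), localEulerPoincareCharacteristic (v.adicCompletion ℚ))
    (T : ∀ k' : ℕ, Finset (HeightOneSpectrum (𝓞 ℚ))) (hv₃T : ∀ k', v₃ ∈ T k')
    (hT : ∀ k', ∀ v : HeightOneSpectrum (𝓞 ℚ), v ∉ T k' →
      (((3 ^ (k' + 1) : ℕ) : ℕ) : 𝓞 ℚ) ∉ v.asIdeal ∧
        GaloisRep.IsUnramifiedAt v (W.torsionGaloisModule (((3 : ℕ) : ℤ) ^ k' * ((3 : ℕ) : ℤ))))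
    (h𝓕T : ∀ k', (propagatedSelmerStructure W 3 k').IsUnramifiedOutside (finSupport (T k')))
    (h𝓚T : ∀ k', (W.kummerSelmerStructure (((3 : ℕ) : ℤ) ^ k' * ((3 : ℕ) : ℤ))).IsUnramifiedOutside
      (finSupport (T k')))
    (hfinT : ∀ k', Finite (geomTorsion W (((3 : ℕ) : ℤ) ^ k' * ((3 : ℕ) : ℤ))))
    (hfinS : ∀ k', Finite (W.kummerSelmerStructure (((3 : ℕ) : ℤ) ^ k' * ((3 : ℕ) : ℤ))).selmerGroup)
    (hPS : ∀ q ∈ D.primes, q ∉ T k) (hPS' : ∀ k', ∀ q ∈ (D' k').primes, q ∉ T k')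
    (hUT : ∀ q ∈ D.primes,
      Nat.card (unramifiedSubgroup (GaloisRep.toLocal q
        (W.torsionGaloisModule (((3 : ℕ) : ℤ) ^ k * ((3 : ℕ) : ℤ)))) 1) =
        Nat.card (D.transverse (Sum.inr q)))
    (hUT' : ∀ k', ∀ q ∈ (D' k').primes,
      Nat.card (unramifiedSubgroup (GaloisRep.toLocal q
        (W.torsionGaloisModule (((3 : ℕ) : ℤ) ^ k' * ((3 : ℕ) : ℤ)))) 1) =
        Nat.card ((D' k').transverse (Sum.inr q)))
    (hR22D : ∀ d, D.IsLevel d →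
      (Nat.card ((inv' k).dualSelmerStructure _
          (D.atLevel (propagatedSelmerStructure W 3 k) d)).selmerGroup ∣ 3 ^ (k + 1) →
        addOrderOf (g d) * Nat.card ((inv' k).dualSelmerStructure _
          (D.atLevel (propagatedSelmerStructure W 3 k) d)).selmerGroup = 3 ^ (k + 1)) ∧
      (3 ^ (k + 1) ∣ Nat.card ((inv' k).dualSelmerStructure _
          (D.atLevel (propagatedSelmerStructure W 3 k) d)).selmerGroup → g d = 0))
    (hR22' : ∀ k' d, (D' k').IsLevel d →
      (Nat.card ((inv' k').dualSelmerStructure _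
          ((D' k').atLevel (propagatedSelmerStructure W 3 k') d)).selmerGroup ∣ 3 ^ (k' + 1) →
        addOrderOf (g' k' d) * Nat.card ((inv' k').dualSelmerStructure _
          ((D' k').atLevel (propagatedSelmerStructure W 3 k') d)).selmerGroup = 3 ^ (k' + 1)) ∧
      (3 ^ (k' + 1) ∣ Nat.card ((inv' k').dualSelmerStructure _
          ((D' k').atLevel (propagatedSelmerStructure W 3 k') d)).selmerGroup → g' k' d = 0))
    -- the shallow datum is a `τ`-datum at level `3^{k+1}` with `S ⊆ {bad} ∪ {v ∣ 3}`, and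
    -- `ρ_{E,3^{k+1}}` is onto
    {S : Set (HeightOneSpectrum (𝓞 ℚ))}
    (hS : ∀ v ∈ S, ¬ W.HasGoodReductionAt v ∨ ((3 : ℕ) : 𝓞 ℚ) ∈ v.asIdeal)
    {τ : absoluteGaloisGroup ℚ}
    (hτμ : τ ∈ rootsOfUnityFixer ℚ (3 ^ (k + 1)))
    (hτq : Nonempty (cokerSubOne (W.torsionGaloisModule (((3 : ℕ) : ℤ) ^ k * ((3 : ℕ) : ℤ))) τ ≃+
      ZMod (3 ^ (k + 1))))
    (hDP : D.primes = frobeniusClassPrimes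
      (W.torsionGaloisModule (((3 : ℕ) : ℤ) ^ k * ((3 : ℕ) : ℤ))) S τ (3 ^ (k + 1)))
    (hsurjK : W.HasSurjectiveModNGaloisRep (((3 : ℕ) : ℤ) ^ k * ((3 : ℕ) : ℤ)))
    -- the certificate in Kim's currency, flag in the records' currency
    (n : ℕ) [NeZero n] (hn : Kato.IsKolyvaginProduct W 3 (k + 1) n)
    (hcyc : ∀ (ℓ : ℕ) [Fact ℓ.Prime], ℓ ∣ n →
      Nat.card {P : ((integralModelInt W).map (Int.castRingHom (ZMod ℓ))).toAffine.Point //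
        3 • P = 0} ≤ 3)
    (hnN : ∀ ℓ ∈ n.primeFactors, ¬ ℓ ∣ N) {j : ℕ} (htj : t + j ≤ k + 1)
    (ψ : (ℓ : ℕ) → (ZMod ℓ)ˣ →* Multiplicative (ZMod (3 ^ j)))
    (hψ : ∀ ℓ ∈ n.primeFactors, Function.Surjective (ψ ℓ))
    (hcert : kuriharaNumber P.f (3 ^ j) n ψ ≠ 0)
    (hv : ∀ d : ℕ, d ∣ n → 1 < d → d < n → ∀ [NeZero d], kuriharaNumber P.f (3 ^ j) d ψ = 0) :
    ∃ q : ℚ, W.entireLFunction 1 / (W.realPeriodRat : ℂ) = (q : ℂ) ∧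
      padicValRat 3 q ≤
        (padicValNat 3 (Nat.card (AddCommGroup.primaryComponent W.sha 3)) : ℤ) + ((j - 1 : ℕ) : ℤ) := by
  haveI : Fact (Nat.Prime 3) := ⟨Nat.prime_three⟩
  refine padicValRat_le_of_kolyvaginProduct_nested_at W t k D v₃ hv₃ hadd hc3 hsurj ht hL P hcP hper hDT g hg
    hgen D' hDT' hPP' red hred hdict g' hg' hgo' hgen' inv' hperf' hsum' hcompl' hinj' hEP T hv₃T hT
    h𝓕T h𝓚T hfinT hfinS hPS hPS' hUT hUT' hR22D hR22' hτμ hτq hDP hsurjK n hn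
    (fun v hv => natCard_torsionBy_reductionAt_le_of_dvd W 3 hcyc hv)
    (fun v hv hvS => ?_) hnN htj ψ hψ hcert hv
  -- a place of `n` is good and prime to `3`, hence off `S`
  obtain ⟨hgood, h3⟩ := hasGoodReductionAt_and_not_mem_of_kolyvaginProduct W 3 hn hv
  rcases hS v hvS with hbad | h3v
  · exact hbad hgood
  · exact h3 h3v

/-! ### (1) Cor C-t at `t = 0`, every depth: the record corollary at shallow depth `k`, modulus `3^j` -/

/-- **n1011's (a′) record corollary at `t = 0` for EVERY shallow depth `k` and certificate modulus `3^j`,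
`j ≤ k + 1`** (the cell memo's Cor C-t at `t = 0`, kernel form, BSD currency; binder diff against
`Assembly.exists_LOmega_padicValRat_le_of_towerSurj_with`: `{h26, hN ≤ 130000}` ↦ `{hcD : 3 ∤ c_D, hper}`,
`{hmod, hr}` ↦ `{hL : L(E,1) ≠ 0}`, `hEP` DISCHARGED, `(k, j)` free instead of `(0, 1)`).  `W/ℚ` globally
minimal, ADDITIVE at `3` with `3 ∤ c₃`, the `3`-adic tower onto, `E(ℚ₃)[3] = 0`, `L(E,1) ≠ 0`, a datum `D`
with `3 ∤ c_D` and the `3`-adic period transfer; `hS24`/`hS24₂`, GZK, the Poitou–Tate families; ONE port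
`KatoKuriharaPortThreeAtWith₂ W 0 v₃ η D`; a certificate at a cyclic `n ∈ 𝒩_{k+1}(E,3)` (`ℓ ∤ N` for
`ℓ ∣ n`, `ψ ↠ ℤ/3^j`, `δ̃^{(j)}_n(ψ) ≠ 0`, `δ̃^{(j)}_d(ψ) = 0` for `1 < d < n`) ⟹
`∃ q, L(E,1)/Ω(W) = q ∧ ord₃ q ≤ ord₃ #Ш(E)(3) + (j − 1)`.  Proof = n1011's, with the shallow datum the
depth-`k` member of the shared-`η` tower family and the nesting supplied above `k` only.
[cite: Kim2022StructureSelmer, Thm. 1.9 (6) and Thm. 3.13] [cite: Sakamoto2024, Thm. 4.4 (p. 926)]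
[cite: MilneADT2006, I §2 Thm 2.8 (p. 31)] -/
theorem exists_LOmega_padicValRat_le_of_towerSurj_with_depth
    (hS24 : Sakamoto2024.kolyvaginSystems_freeRankOne_zmod_three_pow)
    (hS24₂ : Sakamoto2024.kolyvaginSystems_idealOfBasis_eq_fittingIdeal_zmod_three_pow)
    (hGZK : rank_eq_analyticRank_of_analyticRank_le_one)
    (W : WeierstrassCurve ℚ) [W.IsElliptic] [W.IsGloballyMinimal]
    -- the row
    (hadd : haveI : Fact (Nat.Prime 3) := ⟨Nat.prime_three⟩; Addv W 3)
    (hc3 : ¬ 3 ∣ (W.baseChange ℚ_[3]).localTamagawaNumber ℤ_[3])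
    (htower : ∀ m : ℕ, W.HasSurjectiveModNGaloisRep (3 ^ m : ℕ))
    (ht0 : Nat.card {Q : (W.baseChange ℚ_[3]).toAffine.Point // (3 : ℕ) • Q = 0} = 1)
    (hL : W.entireLFunction 1 ≠ 0)
    {N : ℕ} [NeZero N] (D : ModularParametrizationData W N) (hcD : ¬ (3 : ℤ) ∣ D.maninConstant)
    (hper : ∃ u : ℚ, ‖(u : ℚ_[3])‖ = 1 ∧ W.realPeriodRat = u * plusPeriod D.f)
    -- the Poitou–Tate families
    (inv : LocalInvariants ℚ 3) (hperf : inv.IsPerfect) (hsum : inv.SumLocalTermEqZero)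
    (hcompl : inv.SelmerComplement)
    (inv' : ∀ k' : ℕ, LocalInvariants ℚ (3 ^ (k' + 1))) (hperf' : ∀ k', (inv' k').IsPerfect)
    (hsum' : ∀ k', (inv' k').SumLocalTermEqZero) (hcompl' : ∀ k', (inv' k').SelmerComplement)
    (hinj' : ∀ k', ∀ v : HeightOneSpectrum (𝓞 ℚ), Injective (inv' k' (Sum.inr v)))
    -- ONE port (repaired PORT″, shared generator family `η`, keyed at `D`)
    (v₃ : HeightOneSpectrum (𝓞 ℚ)) (hv₃ : ((3 : ℕ) : 𝓞 ℚ) ∈ v₃.asIdeal)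
    (η : (q : HeightOneSpectrum (𝓞 ℚ)) → (ZMod (Ideal.absNorm q.asIdeal))ˣ)
    (hη : ∀ q : HeightOneSpectrum (𝓞 ℚ), Subgroup.zpowers (η q) = ⊤)
    (hPort : KatoKuriharaPortThreeAtWith₂ W 0 v₃ η D)
    -- the certificate: shallow depth `k`, modulus `3^j`
    (k : ℕ) (n : ℕ) [NeZero n] (hn : Kato.IsKolyvaginProduct W 3 (k + 1) n)
    (hcyc : ∀ (ℓ : ℕ) [Fact ℓ.Prime], ℓ ∣ n →
      Nat.card {P : ((integralModelInt W).map (Int.castRingHom (ZMod ℓ))).toAffine.Point //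
        3 • P = 0} ≤ 3)
    (hnN : ∀ ℓ ∈ n.primeFactors, ¬ ℓ ∣ N) {j : ℕ} (hjk : j ≤ k + 1)
    (ψ : (ℓ : ℕ) → (ZMod ℓ)ˣ →* Multiplicative (ZMod (3 ^ j)))
    (hψ : ∀ ℓ ∈ n.primeFactors, Function.Surjective (ψ ℓ))
    (hcert : kuriharaNumber D.f (3 ^ j) n ψ ≠ 0)
    (hv : ∀ d : ℕ, d ∣ n → 1 < d → d < n → ∀ [NeZero d], kuriharaNumber D.f (3 ^ j) d ψ = 0) :
    ∃ q : ℚ, W.entireLFunction 1 / (W.realPeriodRat : ℂ) = (q : ℂ) ∧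
      padicValRat 3 q ≤
        (padicValNat 3 (Nat.card (AddCommGroup.primaryComponent W.sha 3)) : ℤ) + ((j - 1 : ℕ) : ℤ) := by
  haveI : Fact (Nat.Prime 3) := ⟨Nat.prime_three⟩
  -- the row: analytic rank `0`, `E(ℚ)` and `Ш` finite, surjectivity at `3` and at `3^{k+1}`
  have hr : W.analyticRank = 0 := analyticRank_eq_zero_of_entireLFunction_one_ne_zero W hL
  have hGZ := hGZK W (by rw [hr]; exact zero_le_one)
  haveI : Finite W.sha := hGZ.2
  haveI : Finite W.toAffine.Point := W.mordellWeilRank_eq_zero_iff_holds.mp (by rw [hGZ.1, hr])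
  have hsurj : W.HasSurjectiveModNGaloisRep ((3 : ℕ) : ℤ) := by simpa using htower 1
  have hsurjK : W.HasSurjectiveModNGaloisRep (((3 : ℕ) : ℤ) ^ k * ((3 : ℕ) : ℤ)) := by
    simpa only [Nat.cast_pow, Nat.cast_mul, pow_succ] using htower (k + 1)
  have hcP : ¬ ((3 : ℕ) : ℤ) ∣ D.maninConstant := by exact_mod_cast hcD
  -- Tate's local Euler–Poincaré characteristic, by name (proved in the tree)
  have hEP : ∀ v : HeightOneSpectrum (𝓞 ℚ), localEulerPoincareCharacteristic (v.adicCompletion ℚ) :=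
    localEulerPoincareCharacteristic_rat
  -- the admissible set `T = {v ∣ 3} ∪ {bad}` and `S = S(T)`
  obtain ⟨T, h3T, hbadT, hTmem, hT, h𝓕T, h𝓚T, hfinT, hfinS⟩ := TowerPackage.towerAdmissible W
  have hS : ∀ w : InfinitePlace ℚ, (Sum.inl w : Place ℚ) ∈ finSupport T := inl_mem_finSupport T
  have h3S : ∀ v : HeightOneSpectrum (𝓞 ℚ), ((3 : ℕ) : 𝓞 ℚ) ∈ v.asIdeal →
      (Sum.inr v : Place ℚ) ∈ finSupport T := fun v hv => (inr_mem_finSupport_iff T v).mpr (h3T v hv)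
  have hbadS : ∀ v : HeightOneSpectrum (𝓞 ℚ), ¬ W.HasGoodReductionAt v →
      (Sum.inr v : Place ℚ) ∈ finSupport T := fun v hv => (inr_mem_finSupport_iff T v).mpr (hbadT v hv)
  have hSgood : ∀ v ∉ {v : HeightOneSpectrum (𝓞 ℚ) | (Sum.inr v : Place ℚ) ∈ finSupport T},
      W.HasGoodReductionAt v ∧ ((3 : ℕ) : 𝓞 ℚ) ∉ v.asIdeal := fun v hv =>
    ⟨by_contra fun h => hv (hbadS v h), fun h => hv (h3S v h)⟩
  have hSmem : ∀ v ∈ {v : HeightOneSpectrum (𝓞 ℚ) | (Sum.inr v : Place ℚ) ∈ finSupport T},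
      ¬ W.HasGoodReductionAt v ∨ ((3 : ℕ) : 𝓞 ℚ) ∈ v.asIdeal := fun v hv =>
    hTmem v ((inr_mem_finSupport_iff T v).mp hv)
  -- the shared-`η` tower family (pinned at every depth) and the reduction maps to depth `k`
  obtain ⟨τ, D', g', hτμ, hτq, hP', hDT', hD', hg', hgo', hgen', hR22', hUT', hPS', -⟩ :=
    TowerPackage.exists_towerFamily_with W hS24 hS24₂ htower inv hperf hsum hcompl hEP (finSupport T) hS
      h3S hbadS η hη
  choose red hred using fun k' => exists_torsionReduction_three W k k'
  -- every member passes the With-guard; the port unpacks at shallow depth `k`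
  have hDk : ∀ k', (D' k').IsCanonicalTauDatumThreeAtWith W (k' + 0) k' η := fun k' =>
    isCanonicalTauDatumThreeAtWith_of_primes_eq hSgood (hτμ k') (hτq k') (hP' k') (hDT' k') (hD' k')
  have hdict := hPort.dictionary₂At (hDk k) hDk red
  -- nesting ABOVE `k`: deeper pinned classes are smaller (class independence under the tower)
  have hPPk : ∀ k', k ≤ k' → (D' k').primes ⊆ (D' k).primes := fun k' hk' => by
    rw [hP' k', hP' k]
    exact FrobShape.frobeniusClassPrimes_pow_mul_subset_of_le W 3 hk' hsurjK (hτμ k) (hτq k) (hτμ k')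
      (hτq k') _
  -- the nested-only END at `(t, k, j) = (0, k, j)` with shallow datum `D′ k`
  obtain ⟨q, hq, hle⟩ := padicValRat_le_of_kolyvaginProduct_of_card_torsion_le_nested_at W 0 k (D' k) v₃
    hv₃ hadd hc3 hsurj (by rw [ht0, pow_zero]) hL D hcP hper (hDT' k) (g' k) (hg' k) (hgen' k) D' hDT'
    hPPk red hred hdict g' hg' hgo' hgen' inv' hperf' hsum' hcompl' hinj' hEP (fun _ => T)
    (fun _ => h3T v₃ hv₃) hT h𝓕T h𝓚T hfinT hfinS
    (fun q hq => fun h => hPS' k q hq ((inr_mem_finSupport_iff T q).mpr h))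
    (fun k' q hq => fun h => hPS' k' q hq ((inr_mem_finSupport_iff T q).mpr h))
    (hUT' k) hUT'
    (fun d hd => hR22' k (inv' k) (hperf' k) (hsum' k) (hcompl' k) d hd)
    (fun k' d hd => hR22' k' (inv' k') (hperf' k') (hsum' k') (hcompl' k') d hd)
    hSmem (hτμ k) (hτq k) (hP' k) hsurjK n hn hcyc hnN (j := j) (by simpa using hjk) ψ hψ hcert hv
  exact ⟨q, hq, hle⟩

/-! ### (2) Minimality removed: descent to the least certified divisor -/

/-- **The same with an ARBITRARY certificate** (no vanishing at the proper sub-levels): if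
`δ̃^{(j)}_n(ψ) ≠ 0` at a cyclic `n ∈ 𝒩_{k+1}(E,3)`, the least divisor `m ∣ n`, `m > 1`, with
`δ̃^{(j)}_m(ψ) ≠ 0` is again a cyclic level in `𝒩_{k+1}` and carries a MINIMAL certificate (every `d ∣ m`
with `1 < d < m` divides `n` and is smaller than `m`), so `exists_LOmega_padicValRat_le_of_towerSurj_with_depth`
applies at `m`; at `n = 1` the minimality clause is empty. [cite: Kim2022StructureSelmer, Thm. 1.9 (6), §1.2.2 and §1.4.3]
[cite: Sakamoto2024, Thm. 4.4 (p. 926)] -/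
theorem exists_LOmega_padicValRat_le_of_towerSurj_with_depth_of_anyCertificate
    (hS24 : Sakamoto2024.kolyvaginSystems_freeRankOne_zmod_three_pow)
    (hS24₂ : Sakamoto2024.kolyvaginSystems_idealOfBasis_eq_fittingIdeal_zmod_three_pow)
    (hGZK : rank_eq_analyticRank_of_analyticRank_le_one)
    (W : WeierstrassCurve ℚ) [W.IsElliptic] [W.IsGloballyMinimal]
    (hadd : haveI : Fact (Nat.Prime 3) := ⟨Nat.prime_three⟩; Addv W 3)
    (hc3 : ¬ 3 ∣ (W.baseChange ℚ_[3]).localTamagawaNumber ℤ_[3])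
    (htower : ∀ m : ℕ, W.HasSurjectiveModNGaloisRep (3 ^ m : ℕ))
    (ht0 : Nat.card {Q : (W.baseChange ℚ_[3]).toAffine.Point // (3 : ℕ) • Q = 0} = 1)
    (hL : W.entireLFunction 1 ≠ 0)
    {N : ℕ} [NeZero N] (D : ModularParametrizationData W N) (hcD : ¬ (3 : ℤ) ∣ D.maninConstant)
    (hper : ∃ u : ℚ, ‖(u : ℚ_[3])‖ = 1 ∧ W.realPeriodRat = u * plusPeriod D.f)
    (inv : LocalInvariants ℚ 3) (hperf : inv.IsPerfect) (hsum : inv.SumLocalTermEqZero)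
    (hcompl : inv.SelmerComplement)
    (inv' : ∀ k' : ℕ, LocalInvariants ℚ (3 ^ (k' + 1))) (hperf' : ∀ k', (inv' k').IsPerfect)
    (hsum' : ∀ k', (inv' k').SumLocalTermEqZero) (hcompl' : ∀ k', (inv' k').SelmerComplement)
    (hinj' : ∀ k', ∀ v : HeightOneSpectrum (𝓞 ℚ), Injective (inv' k' (Sum.inr v)))
    (v₃ : HeightOneSpectrum (𝓞 ℚ)) (hv₃ : ((3 : ℕ) : 𝓞 ℚ) ∈ v₃.asIdeal)
    (η : (q : HeightOneSpectrum (𝓞 ℚ)) → (ZMod (Ideal.absNorm q.asIdeal))ˣ)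
    (hη : ∀ q : HeightOneSpectrum (𝓞 ℚ), Subgroup.zpowers (η q) = ⊤)
    (hPort : KatoKuriharaPortThreeAtWith₂ W 0 v₃ η D)
    (k : ℕ) (n : ℕ) [NeZero n] (hn : Kato.IsKolyvaginProduct W 3 (k + 1) n)
    (hcyc : ∀ (ℓ : ℕ) [Fact ℓ.Prime], ℓ ∣ n →
      Nat.card {P : ((integralModelInt W).map (Int.castRingHom (ZMod ℓ))).toAffine.Point //
        3 • P = 0} ≤ 3)
    (hnN : ∀ ℓ ∈ n.primeFactors, ¬ ℓ ∣ N) {j : ℕ} (hjk : j ≤ k + 1)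
    (ψ : (ℓ : ℕ) → (ZMod ℓ)ˣ →* Multiplicative (ZMod (3 ^ j)))
    (hψ : ∀ ℓ ∈ n.primeFactors, Function.Surjective (ψ ℓ))
    (hcert : kuriharaNumber D.f (3 ^ j) n ψ ≠ 0) :
    ∃ q : ℚ, W.entireLFunction 1 / (W.realPeriodRat : ℂ) = (q : ℂ) ∧
      padicValRat 3 q ≤
        (padicValNat 3 (Nat.card (AddCommGroup.primaryComponent W.sha 3)) : ℤ) + ((j - 1 : ℕ) : ℤ) := by
  have hn0 : n ≠ 0 := hn.ne_zero
  -- the certified divisors `> 1`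
  let P : ℕ → Prop := fun d => ∃ _ : d ∣ n ∧ 1 < d,
    (haveI : NeZero d := ⟨by omega⟩; kuriharaNumber D.f (3 ^ j) d ψ) ≠ 0
  by_cases h1 : n = 1
  · -- `n = 1`: no proper divisor `1 < d < n`
    subst h1
    exact exists_LOmega_padicValRat_le_of_towerSurj_with_depth hS24 hS24₂ hGZK W hadd hc3 htower ht0 hL D
      hcD hper inv hperf hsum hcompl inv' hperf' hsum' hcompl' hinj' v₃ hv₃ η hη hPort k 1 hn hcyc hnN hjk
      ψ hψ hcert (fun d hd h1d hdn => absurd (Nat.le_of_dvd one_pos hd) (by omega))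
  · have h1n : 1 < n := by
      rcases Nat.lt_or_ge 1 n with h | h
      · exact h
      · exact absurd (le_antisymm h (Nat.one_le_iff_ne_zero.mpr hn0)) h1
    have hP : ∃ d, P d := ⟨n, ⟨dvd_rfl, h1n⟩, hcert⟩
    set m := Nat.find hP with hm
    obtain ⟨⟨hmn, h1m⟩, hcm⟩ : P m := Nat.find_spec hP
    haveI : NeZero m := ⟨by omega⟩
    refine exists_LOmega_padicValRat_le_of_towerSurj_with_depth hS24 hS24₂ hGZK W hadd hc3 htower ht0 hL D
      hcD hper inv hperf hsum hcompl inv' hperf' hsum' hcompl' hinj' v₃ hv₃ η hη hPort k m (hn.of_dvd hmn)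
      (fun ℓ _ hℓ => hcyc ℓ (hℓ.trans hmn)) (fun ℓ hℓ => hnN ℓ (Nat.primeFactors_mono hmn hn0 hℓ)) hjk ψ
      (fun ℓ hℓ => hψ ℓ (Nat.primeFactors_mono hmn hn0 hℓ)) hcm (fun d hd h1d hdm => ?_)
    -- a proper divisor `1 < d < m` is a smaller divisor of `n`, hence uncertified
    intro _
    by_contra hne
    exact Nat.find_min hP (hm ▸ hdm) ⟨⟨hd.trans hmn, h1d⟩, hne⟩

end Summit.BirchSwinnertonDyer.BirchSwinnertonDyer.Theorems.KimAtThreeKolyvaginDeepLowerKatoStratum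

end
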